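import Mathlib
import HarnessLib
import Summits.HodgeConjecture.Statement
import Literature.AlgebraicGeometry.HodgeTheory.HodgeConjecture
import Literature.AlgebraicGeometry.HodgeTheory.HodgeFiltration
import Literature.AlgebraicGeometry.HodgeTheory.HodgeModelExistence
import Literature.AlgebraicGeometry.HodgeTheory.ComplexConjugationHolds
import Literature.AlgebraicGeometry.HodgeTheory.ComplexGysin
import Literature.AlgebraicGeometry.HodgeTheory.GysinFormalism
import Literature.AlgebraicGeometry.HodgeTheory.GysinFormalismCorrespondences
import Literature.AlgebraicGeometry.Motives.FamiliesVHS
import Literature.AlgebraicGeometry.Motives.BaseChange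
import Literature.AlgebraicGeometry.Motives.Differentials
import Literature.Geometry.Kaehler.HolomorphicChartForms

/-!
# Route `NikulinTwinTransport`, crux `SectorComplement` (stmt-HodgeConjecture-13684): the BC2-redirect
# DECOMPOSITION of the declared complement frame onto the anchor programme

Crux-strategist seat `planner-cstrat-stmt-HodgeConjecture-13684-r1-0` (route re-audit, bin RESTATED,
2026-08-17). The crux `SectorComplement := SquareHodgeOfSqrtTwo → HodgeConjecture` is the route's
declared complement of its sector `Σ := SquareHodgeOfSqrtTwo` (HC for squares of projective K3 surfaces
with real multiplication by `√2`). Its definitional cone is `{Σ, HC}` and it is equivalent to the summit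
modulo Σ (p84060, `Theorems/NikulinTwinTransportSectorComplement.lean`), so under the BC2 rule
"restated is a redirect" it must be DECOMPOSED into pieces none of which is the summit.

The decomposition filed by this seat is the anchor/transport seam of Grothendieck's programme — the
general form of this route's own paradigm (carry a class from an anchor where it is algebraic):

* `Sub₁` = the body, symbol for symbol, of `Theses.AnchorTransport.VariationalHodge`
  (stmt-HodgeConjecture-1076; Grothendieck's variational Hodge conjecture, global-class form);
* `Sub₂` = the body, symbol for symbol, of `Theses.AnchorTransport.AnchorExistence`
  (stmt-HodgeConjecture-1077; every Hodge class deforms, in a smooth projective family with a flat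
  Hodge section, to a fibre where it is algebraic);
* conclusion = the body of `Theses.NikulinTwinTransport.SectorComplement` with `Σ` spelled out as the
  body of `Theses.NikulinTwinTransport.SquareHodgeOfSqrtTwo` (stmt-HodgeConjecture-13680).

Because the three bodies are verbatim, the theorem `sectorComplement_of_subs` has, by `δ`-unfolding,
the type `AnchorTransport.VariationalHodge → AnchorTransport.AnchorExistence →
NikulinTwinTransport.SectorComplement`; it is kept ROUTE-FILE-FREE (no `Theses` import, direct or
transitive) so that the gate can link it from the route file as the glue of
`ledger route edit route-HodgeConjecture-NikulinTwinTransport --split SectorComplement --glue-by …`,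
whose two children then DEDUP onto the existing items 1076 / 1077 (no new item, no new chain).
THIS COPY is the crux WORKFILE (namespace `…Cruxes.SectorComplement.AnchorSplitGlueStandalone`); the
prover-landable twin with namespace `…Theorems.NikulinTwinTransportSectorComplementSplit` (target
`Theorems/NikulinTwinTransportSectorComplementSplit.lean --supports stmt-HodgeConjecture-13684`) is attached to
the item as evidence `SplitGlue.lean` — distinct namespaces so that both may coexist in one import closure.

Proof (Grothendieck 1966, footnote 13; Charles–Schnell 2014 §11.3): fix a smooth projective `X` and a
rational `(p,p)` class `c`; the anti-vacuity conjunct of `HodgeConjectureFor` is the THEOREM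
`nonempty_hodgeModel_holds`; `Sub₂` supplies a family `f : 𝒳 ⟶ S`, points `s₁, s₀`, an iso
`e : X ≅ 𝒳_{s₁}` and a global class `A` with `e^*(A|_{s₁}) = c` and `A|_{s₀}` algebraic; `Sub₁`
transports algebraicity from `s₀` to `s₁`; and algebraic classes pull back along the isomorphism `e`
(`map_mem_algebraicClasses_of_iso`, re-derived here from the support filtration so that the module
stays route-file-free: a class dying off a closed `Z` of codimension `≥ p` pulls back to a class
dying off `e⁻¹Z`, and isomorphisms preserve `Order.coheight`). The hypothesis `Σ` of the conclusion is
NOT used: the complement is discharged by the anchor programme outright — recorded, not hidden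
(STRATEGY-CENSUS Part r1). No `sorry`, no new `def`, nothing asserted.
-/

noncomputable section

open CategoryTheory AlgebraicGeometry
open Literature.AlgebraicGeometry Literature.AlgebraicGeometry.HodgeTheory
open scoped Manifold

namespace Summit.HodgeConjecture.HodgeConjecture.Cruxes.SectorComplement.AnchorSplitGlueStandalone

-- `dupNamespace`: summit and sub-problem are both named `HodgeConjecture` (layout D-0017/D-0022)
set_option linter.dupNamespace false

/-- **Isomorphisms of `ℂ`-schemes transport algebraic classes**: for `e : X ≅ Y` over `Spec ℂ` and
`y ∈ Nᵖ H²ᵖ(Y(ℂ); ℂ)`, `e^* y ∈ Nᵖ H²ᵖ(X(ℂ); ℂ)`. A generator of `Nᵖ H²ᵖ(Y)` dies on `(Y ∖ Z)(ℂ)`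
for a Zariski-closed `Z` of codimension `≥ p`; its pull-back dies on `(X ∖ e⁻¹Z)(ℂ)`
(`complexBetti.restrictCompl_map_eq_zero`), and `codim x = codim e(x)` because `e.hom.left` is an open
immersion (`coheight_eq_of_isOpenImmersion`). Same statement as the landed support `IsoInvariance`
(stmt-HodgeConjecture-1078, `Theorems.isoInvariance_proof`), re-derived to keep this module free of
`Theses` imports. [cite: Fulton1998, §19.1] -/
theorem map_mem_algebraicClasses_of_iso {X Y : Motives.SchemeOver ℂ} (e : X ≅ Y) {p : ℕ}
    {y : complexBetti Y (2 * p)} (hy : y ∈ algebraicClasses Y p) :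
    complexBetti.map e.hom (2 * p) y ∈ algebraicClasses X p := by
  suffices h : supportedClasses Y (2 * p) p ≤
      (supportedClasses X (2 * p) p).comap (complexBetti.map e.hom (2 * p)).hom from h hy
  refine iSup_le fun S ↦ iSup_le fun hS ↦ iSup_le fun hc ↦ fun z hz ↦ ?_
  rw [LinearMap.mem_ker] at hz
  refine mem_supportedClasses_of_restrictCompl_eq_zero (hS.preimage e.hom.left.base.hom.continuous)
    (fun w hw ↦ (hc _ hw).trans (coheight_eq_of_isOpenImmersion e.hom.left).le) ?_
  exact complexBetti.restrictCompl_map_eq_zero e.hom hz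

/-- **Strategist's split of `NikulinTwinTransport.SectorComplement`** (stmt-HodgeConjecture-13684):
`Sub₁ → Sub₂ → SectorComplement`, where `Sub₁` is the body of `AnchorTransport.VariationalHodge`
(stmt-HodgeConjecture-1076) verbatim, `Sub₂` the body of `AnchorTransport.AnchorExistence`
(stmt-HodgeConjecture-1077) verbatim, and the conclusion the body of `SectorComplement` with
`SquareHodgeOfSqrtTwo` (stmt-HodgeConjecture-13680) spelled out verbatim. Given a smooth projective `X`
and a rational `(p,p)` class `c`: anchor (`Sub₂`), transport along the family (`Sub₁`), pull back
along `e : X ≅ 𝒳_{s₁}` (`map_mem_algebraicClasses_of_iso`); the Hodge-model conjunct of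
`HodgeConjectureFor` is `nonempty_hodgeModel_holds`. The sector hypothesis is discarded.
[cite: CharlesSchnell2014Notes, §11.3 Conj. 11.3.1 and Cor. 11.3.6] -/
theorem sectorComplement_of_subs :
    (∀ ⦃n : ℕ⦄ ⦃𝒳 S : Literature.AlgebraicGeometry.Motives.SchemeOver ℂ⦄ (f : 𝒳 ⟶ S), Literature.AlgebraicGeometry.Motives.IsSmoothProjectiveFamily f n → IrreducibleSpace S.left → AlgebraicGeometry.Smooth S.hom → ∀ (p : ℕ) (A : Literature.AlgebraicGeometry.HodgeTheory.complexBetti 𝒳 (2 * p)), (∀ s : Literature.AlgebraicGeometry.Motives.ComplexPoints S, Literature.AlgebraicGeometry.HodgeTheory.IsRationalClass (Literature.AlgebraicGeometry.HodgeTheory.complexBetti.map (Literature.AlgebraicGeometry.Motives.fiberι f s) (2 * p) A) ∧ Literature.AlgebraicGeometry.HodgeTheory.IsOfHodgeType n (Literature.AlgebraicGeometry.Motives.fiberOver f s) (2 * p) p p (Literature.AlgebraicGeometry.HodgeTheory.complexBetti.map (Literature.AlgebraicGeometry.Motives.fiberι f s) (2 * p) A)) → (∃ s₀ : Literature.AlgebraicGeometry.Motives.ComplexPoints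 S, Literature.AlgebraicGeometry.HodgeTheory.complexBetti.map (Literature.AlgebraicGeometry.Motives.fiberι f s₀) (2 * p) A ∈ Literature.AlgebraicGeometry.HodgeTheory.algebraicClasses (Literature.AlgebraicGeometry.Motives.fiberOver f s₀) p) → ∀ s : Literature.AlgebraicGeometry.Motives.ComplexPoints S, Literature.AlgebraicGeometry.HodgeTheory.complexBetti.map (Literature.AlgebraicGeometry.Motives.fiberι f s) (2 * p) A ∈ Literature.AlgebraicGeometry.HodgeTheory.algebraicClasses (Literature.AlgebraicGeometry.Motives.fiberOver f s) p) →
    (∀ ⦃n : ℕ⦄ ⦃X : Literature.AlgebraicGeometry.Motives.SchemeOver ℂ⦄, Literature.AlgebraicGeometry.Motives.IsSmoothProjective n X → ∀ (p : ℕ) (c : Literature.AlgebraicGeometry.HodgeTheory.complexBetti X (2 * p)), Literature.AlgebraicGeometry.HodgeTheory.IsRationalClass c → Literature.AlgebraicGeometry.HodgeTheory.IsOfHodgeType n X (2 * p) p p c → ∃ (𝒳 S : Literature.AlgebraicGeometry.Motives.SchemeOver ℂ) (f : 𝒳 ⟶ S) (s₁ s₀ : Literature.AlgebraicGeometry.Motives.ComplexPoints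 S) (e : X ≅ Literature.AlgebraicGeometry.Motives.fiberOver f s₁) (A : Literature.AlgebraicGeometry.HodgeTheory.complexBetti 𝒳 (2 * p)), Literature.AlgebraicGeometry.Motives.IsSmoothProjectiveFamily f n ∧ IrreducibleSpace S.left ∧ AlgebraicGeometry.Smooth S.hom ∧ (∀ s : Literature.AlgebraicGeometry.Motives.ComplexPoints S, Literature.AlgebraicGeometry.HodgeTheory.IsRationalClass (Literature.AlgebraicGeometry.HodgeTheory.complexBetti.map (Literature.AlgebraicGeometry.Motives.fiberι f s) (2 * p) A) ∧ Literature.AlgebraicGeometry.HodgeTheory.IsOfHodgeType n (Literature.AlgebraicGeometry.Motives.fiberOver f s) (2 * p) p p (Literature.AlgebraicGeometry.HodgeTheory.complexBetti.map (Literature.AlgebraicGeometry.Motives.fiberι f s) (2 * p) A)) ∧ Literature.AlgebraicGeometry.HodgeTheory.complexBetti.map e.hom (2 * p) (Literature.AlgebraicGeometry.HodgeTheory.complexBetti.map (Literature.AlgebraicGeometry.Motives.fiberι f s₁) (2 * p) A) = c ∧ Literature.AlgebraicGeometry.HodgeTheory.complexBetti.map (Literature.AlgebraicGeometry.Motives.fiberι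 f s₀) (2 * p) A ∈ Literature.AlgebraicGeometry.HodgeTheory.algebraicClasses (Literature.AlgebraicGeometry.Motives.fiberOver f s₀) p) →
    ((∀ (S : Literature.AlgebraicGeometry.Motives.SchemeOver ℂ), (Literature.AlgebraicGeometry.Motives.IsSmoothProjective 2 S ∧ Subsingleton (Literature.AlgebraicGeometry.Motives.structureSheafCohomology S.left 1) ∧ ∃ (A : Literature.AlgebraicGeometry.HodgeTheory.HodgeModel 2 S) (η : Literature.Geometry.Kaehler.MForm 𝓘(ℝ, A.model) A.carrier ℂ 2), Literature.Geometry.Kaehler.IsHolomorphicInCharts η ∧ ∀ x, η x ≠ 0) → ∀ (e : Literature.AlgebraicGeometry.HodgeTheory.complexBetti S (2 * 1) →ₗ[ℂ] Literature.AlgebraicGeometry.HodgeTheory.complexBetti S (2 * 1)), (∀ x, Literature.AlgebraicGeometry.HodgeTheory.IsRationalClass x → Literature.AlgebraicGeometry.HodgeTheory.IsRationalClass (e x)) → (∀ (i j : ℕ) x, Literature.AlgebraicGeometry.HodgeTheory.IsOfHodgeType 2 S (2 * 1) i j x → Literature.AlgebraicGeometry.HodgeTheory.IsOfHodgeType 2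 S (2 * 1) i j (e x)) → (∀ x y : Literature.AlgebraicGeometry.HodgeTheory.complexBetti S (2 * 1), Literature.AlgebraicTopology.SingularHomology.cupProduct (rfl : 2 * 1 + 2 * 1 = 2 * 2) (e x) y = Literature.AlgebraicTopology.SingularHomology.cupProduct (rfl : 2 * 1 + 2 * 1 = 2 * 2) x (e y)) → (∀ d ∈ Literature.AlgebraicGeometry.HodgeTheory.algebraicClasses S 1, e d = 0) → (∀ x : Literature.AlgebraicGeometry.HodgeTheory.complexBetti S (2 * 1), (∀ d ∈ Literature.AlgebraicGeometry.HodgeTheory.algebraicClasses S 1, Literature.AlgebraicTopology.SingularHomology.cupProduct (rfl : 2 * 1 + 2 * 1 = 2 * 2) x d = 0) → e (e x) = (2 : ℂ) • x) → (∀ (f : Literature.AlgebraicGeometry.HodgeTheory.complexBetti S (2 * 1) →ₗ[ℂ] Literature.AlgebraicGeometry.HodgeTheory.complexBetti S (2 * 1)), (∀ x, Literature.AlgebraicGeometry.HodgeTheory.IsRationalClass x → Literature.AlgebraicGeometry.HodgeTheory.IsRationalClass (f x)) → (∀ (i j : ℕ) x, Literature.AlgebraicGeometry.HodgeTheory.IsOfHodgeType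 2 S (2 * 1) i j x → Literature.AlgebraicGeometry.HodgeTheory.IsOfHodgeType 2 S (2 * 1) i j (f x)) → (∀ d ∈ Literature.AlgebraicGeometry.HodgeTheory.algebraicClasses S 1, f d = 0) → (∀ x : Literature.AlgebraicGeometry.HodgeTheory.complexBetti S (2 * 1), ∀ d ∈ Literature.AlgebraicGeometry.HodgeTheory.algebraicClasses S 1, Literature.AlgebraicTopology.SingularHomology.cupProduct (rfl : 2 * 1 + 2 * 1 = 2 * 2) (f x) d = 0) → ∃ a b : ℚ, ∀ x : Literature.AlgebraicGeometry.HodgeTheory.complexBetti S (2 * 1), (∀ d ∈ Literature.AlgebraicGeometry.HodgeTheory.algebraicClasses S 1, Literature.AlgebraicTopology.SingularHomology.cupProduct (rfl : 2 * 1 + 2 * 1 = 2 * 2) x d = 0) → f x = (a : ℂ) • x + (b : ℂ) • e x) → Literature.AlgebraicGeometry.HodgeTheory.HodgeConjectureFor 4 (CategoryTheory.MonoidalCategoryStruct.tensorObj S S)) → _root_.HodgeConjecture) := by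
  intro hV hAn _hSector n X hX
  -- the summit for `X` is its cycle part: the anti-vacuity conjunct `Nonempty (HodgeModel n X)` of
  -- `HodgeConjectureFor` is a theorem of the tree (`nonempty_hodgeModel_holds`)
  refine (hodgeConjectureFor_iff_of_isSmoothProjective nonempty_hodgeModel_holds hX).2 ?_
  intro p c hc hpp
  -- ANCHOR: a smooth projective family through `X ≅ 𝒳_{s₁}` carrying `c` as the restriction of a
  -- global, fibrewise Hodge class `A` that is algebraic on the fibre over `s₀`
  obtain ⟨𝒳, S, f, s₁, s₀, e, A, hf, hirr, hsm, hfib, hAc, hs₀⟩ := hAn hX p c hc hpp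
  -- TRANSPORT: algebraicity of `A|_{s₀}` propagates to every fibre, in particular to `s₁`
  have h₁ : complexBetti.map (Motives.fiberι f s₁) (2 * p) A ∈
      algebraicClasses (Motives.fiberOver f s₁) p :=
    hV f hf hirr hsm p A hfib ⟨s₀, hs₀⟩ s₁
  -- PULL BACK along the isomorphism `e : X ≅ 𝒳_{s₁}` and rewrite `e^*(A|_{s₁}) = c`
  have h₂ := map_mem_algebraicClasses_of_iso e h₁
  rw [hAc] at h₂
  exact h₂

end Summit.HodgeConjecture.HodgeConjecture.Cruxes.SectorComplement.AnchorSplitGlueStandalone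

end
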